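import Literature.NumberTheory.GaloisRepresentations.ArtinConductorDischargeProofs
import Literature.NumberTheory.GaloisRepresentations.ArtinRepresentationHasseArfProofs
import HarnessLib

/-!
# The conductor-exponent specifications from the Hasse–Arf theorem alone
(trunk GalRep, item C10; end-to-end assembly for the provefact item `natCast_artinConductorExponent`)

Theorems only.  The provefact item `Literature.NumberTheory.GaloisRepresentations.GaloisRep.natCast_artinConductorExponent`
(`ArtinConductor.lean`; Katz, *Gauss sums, Kloosterman sums, and monodromy groups*, Prop. 1.9) is
mis-stated as vendored (arbitrary topology on the module, hence arbitrary abstract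
representations; see its docstring and the faithfulness notes of `ArtinConductor.lean`).  Its
faithful forms are the named facts `natCast_artinConductorExponent_of_hasOpenInertiaKerAt` (Prop. 1.9
as printed: inertia acts through a finite discrete quotient) and
`natCast_artinConductorExponent_lAdic` (Prop. 1.9 with Remark 1.10: continuous `λ`-adic
representations), and the Hausdorff theorem-form `natCast_artinConductorExponent_of_t2Space`.
`ArtinConductorDischargeProofs` derives each of them from the degree-one integrality
`hHA : card_inf_inertia_dvd_finsum_card_inf_ramificationSubgroup` (Serre VI §2, Cor. to Prop. 5) on
the finite normal layers of `K̄/K`, and `ArtinRepresentationHasseArfProofs` reduces that input to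
the **Hasse–Arf theorem** (`Literature.NumberTheory.GaloisRepresentations.hasseArf`, Serre IV §3) by Herbrand's theorem
(`card_inf_inertia_dvd_finsum_card_inf_ramificationSubgroup_of_hasseArf`).  This file composes the
two (the reduction being applied layer by layer), so that every faithful form of the item is a
theorem **conditional on exactly one printed theorem absent from the tree, Hasse–Arf** (plus, for
coefficient fields of positive characteristic only, Artin's theorem over finite fields,
`exists_natCast_eq_artinExponent_finiteField`, Katz 1.9 for `A = 𝔽_λ` / Serre *LinRep* §19.3):

* `Literature.NumberTheory.GaloisRepresentations.GaloisRep.natCast_artinConductorExponent_lAdic_of_hasseArf` — the `λ`-adic specification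
  (the form used for Tate modules), from `hasseArf` alone;
* `Literature.NumberTheory.GaloisRepresentations.GaloisRep.natCast_artinConductorExponent_of_t2Space_of_hasseArf_charZero` — the Hausdorff form
  over coefficient fields of characteristic `0` (Artin representations, `A = ℂ`), from `hasseArf`
  alone;
* `Literature.NumberTheory.GaloisRepresentations.GaloisRep.natCast_artinConductorExponent_of_hasOpenInertiaKerAt_of_hasseArf_charZero` — the
  finite-quotient form, pointwise over a coefficient field of characteristic `0`, from `hasseArf`
  alone;
* `Literature.NumberTheory.GaloisRepresentations.GaloisRep.natCast_artinConductorExponent_of_t2Space_of_hasseArf`,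
  `Literature.NumberTheory.GaloisRepresentations.GaloisRep.natCast_artinConductorExponent_of_hasOpenInertiaKerAt_of_hasseArf` — all characteristics
  `≠ p`, from `hasseArf` and the finite-field case.

Once `hasseArf` is discharged (`hasseArf_holds`, universe-polymorphic), feeding it here yields
`natCast_artinConductorExponent_lAdic_holds` and, with the finite-field case,
`natCast_artinConductorExponent_of_hasOpenInertiaKerAt_holds`; the original
`natCast_artinConductorExponent` admits no such discharge (it is not a statement of the sources).

## References

* N. M. Katz, *Gauss Sums, Kloosterman Sums, and Monodromy Groups*, Annals of Math. Studies 116,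
  Princeton 1988, Ch. 1: 1.1, 1.8, Prop. 1.9 and its proof, Remark 1.10 (pp. 1–5 of Ch. 1).
  [Katz1988]
* J.-P. Serre, *Local Fields*, GTM 67 (1979), Ch. IV §3 (Herbrand, Hasse–Arf); Ch. VI §2 Prop. 5
  and Cor., Thm 1' (proof, p. 103), §3 (globalisation). [SerreLocalFields1979]
-/

noncomputable section

namespace Literature.NumberTheory.GaloisRepresentations

namespace GaloisRep

open scoped NumberField
open Field IsDedekindDomain

universe u v w

variable {K : Type u} [Field K]

/-- **The `λ`-adic specification of the conductor exponent from the Hasse–Arf theorem alone**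
(`natCast_artinConductorExponent_lAdic` of `ArtinConductor.lean`: for a number field `K`, a
continuous representation `ρ` of `Γ_K` on a finite-dimensional vector space over a finite
extension of `ℚ_ℓ` with its module topology, a finite place `v ∤ ℓ` and any `𝔓 ∣ v`,
`(a_v(ρ) : ℝ) = a_𝔓(ρ)`).  Katz, Prop. 1.9 with Remark 1.10; the only undischarged input is
Hasse–Arf (`hHA`, for the finite Galois extensions in the universe of `K`).
[cite: Katz1988, Ch. 1, Prop. 1.9 and Remark 1.10]
[cite: SerreLocalFields1979, Ch. IV §3, Theorem (Hasse–Arf)] -/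
theorem natCast_artinConductorExponent_lAdic_of_hasseArf
    (hHA : ∀ (R' K' L' : Type u) [CommRing R'] [Field K'] [Field L'] [Algebra R' K']
      [Algebra R' L'] [Algebra K' L'] [IsScalarTower R' K' L'], hasseArf R' (K := K') (L := L'))
    [NumberField K] : natCast_artinConductorExponent_lAdic.{u, v, w} (K := K) :=
  natCast_artinConductorExponent_lAdic_of_arith
    (fun _ _ _ _ => card_inf_inertia_dvd_finsum_card_inf_ramificationSubgroup_of_hasseArf hHA)

/-- **Katz 1.9–1.10 (`ℓ`-adic integrality `a_𝔓(ρ) ∈ ℕ`) from the Hasse–Arf theorem alone**: the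
named fact `exists_natCast_eq_artinConductorAt_lAdic` of `ArtinConductorIntegrality.lean`.
[cite: Katz1988, Ch. 1, Prop. 1.9 and Remark 1.10]
[cite: SerreLocalFields1979, Ch. IV §3, Theorem (Hasse–Arf)] -/
theorem exists_natCast_eq_artinConductorAt_lAdic_of_hasseArf
    (hHA : ∀ (R' K' L' : Type u) [CommRing R'] [Field K'] [Field L'] [Algebra R' K']
      [Algebra R' L'] [Algebra K' L'] [IsScalarTower R' K' L'], hasseArf R' (K := K') (L := L')) :
    exists_natCast_eq_artinConductorAt_lAdic.{u, v, w} (K := K) :=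
  exists_natCast_eq_artinConductorAt_lAdic_of_arith
    (fun _ _ _ _ => card_inf_inertia_dvd_finsum_card_inf_ramificationSubgroup_of_hasseArf hHA)

/-- **The Hausdorff form of the conductor-exponent specification over coefficient fields of
characteristic `0`, from the Hasse–Arf theorem alone.**  For a number field `K`, `𝔓 ∣ v`, a
continuous finite-dimensional `ρ : Γ_K → GL(M)` over a field `A` of characteristic `0` (any
topology on `A`) on a Hausdorff `A`-module `M`, with finite wild image at `𝔓`:
`(a_v(ρ) : ℝ) = a_𝔓(ρ)` — this is the provefact statement `natCast_artinConductorExponent` with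
`[T2Space M]` and `[CharZero A]` added (covers Artin representations, `A = ℂ`).
[cite: Katz1988, Ch. 1, Prop. 1.9 (proof) and Remark 1.10]
[cite: SerreLocalFields1979, Ch. VI §2, Thm 1' and Ch. IV §3, Theorem (Hasse–Arf)] -/
theorem natCast_artinConductorExponent_of_t2Space_of_hasseArf_charZero
    (hHA : ∀ (R' K' L' : Type u) [CommRing R'] [Field K'] [Field L'] [Algebra R' K']
      [Algebra R' L'] [Algebra K' L'] [IsScalarTower R' K' L'], hasseArf R' (K := K') (L := L'))
    [NumberField K] {A : Type v} [Field A] [CharZero A] [TopologicalSpace A] {M : Type w}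
    [AddCommGroup M] [Module A M] [TopologicalSpace M] [T2Space M] [FiniteDimensional A M]
    {v : HeightOneSpectrum (𝓞 K)} {𝔓 : Ideal (absIntegers (𝓞 K) K)} (h𝔓 : 𝔓 ∈ v.primesAbove)
    (ρ : GaloisRep K A M) (hchar : (v.residueCard : A) ≠ 0) (hρ : ρ.HasFiniteWildImageAt (𝓞 K) 𝔓) :
    (ρ.artinConductorExponent v : ℝ) = ρ.artinConductorAt (𝓞 K) 𝔓 :=
  natCast_artinConductorExponent_of_t2Space_of_arith_charZero
    (fun _ _ _ _ => card_inf_inertia_dvd_finsum_card_inf_ramificationSubgroup_of_hasseArf hHA) h𝔓 ρ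
    hchar hρ

/-- **The finite-quotient form (Katz 1.9 as printed), pointwise over a coefficient field of
characteristic `0`, from the Hasse–Arf theorem alone.**  For a number field `K`, any `𝔓 ∣ v`, a
finite-dimensional `ρ` over a field `A` of characteristic `0` whose restriction to `I_𝔓` factors
through a finite discrete quotient (`HasOpenInertiaKerAt`): `(a_v(ρ) : ℝ) = a_𝔓(ρ)`.  Assembled
from `exists_natCast_eq_artinConductorAt_of_hasOpenInertiaKerAt_of_hasseArf_charZero`
(`ArtinRepresentationHasseArfProofs`), the discharged independence of the prime
(`artinConductorAt_eq_of_mem_primesAbove_holds`) and `⌊n⌋₊ = n`.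
[cite: Katz1988, Ch. 1, Prop. 1.9 (and its proof)]
[cite: SerreLocalFields1979, Ch. VI §2 Thm 1', §3, and Ch. IV §3, Theorem (Hasse–Arf)] -/
theorem natCast_artinConductorExponent_of_hasOpenInertiaKerAt_of_hasseArf_charZero
    (hHA : ∀ (R' K' L' : Type u) [CommRing R'] [Field K'] [Field L'] [Algebra R' K']
      [Algebra R' L'] [Algebra K' L'] [IsScalarTower R' K' L'], hasseArf R' (K := K') (L := L'))
    [NumberField K] {A : Type v} [Field A] [CharZero A] [TopologicalSpace A] {M : Type w}
    [AddCommGroup M] [Module A M] [TopologicalSpace M] [FiniteDimensional A M]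
    {v : HeightOneSpectrum (𝓞 K)} {𝔓 : Ideal (absIntegers (𝓞 K) K)} (h𝔓 : 𝔓 ∈ v.primesAbove)
    (ρ : GaloisRep K A M) (hchar : (v.residueCard : A) ≠ 0) (hρ : ρ.HasOpenInertiaKerAt (𝓞 K) 𝔓) :
    (ρ.artinConductorExponent v : ℝ) = ρ.artinConductorAt (𝓞 K) 𝔓 := by
  obtain ⟨n, hn⟩ :=
    exists_natCast_eq_artinConductorAt_of_hasOpenInertiaKerAt_of_hasseArf_charZero
      (K := K) (A := A) (M := M) hHA h𝔓 ρ hchar hρ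
  rw [artinConductorExponent, artinConductorAt_eq_of_mem_primesAbove_holds
    (HeightOneSpectrum.primesAbove_nonempty v).some_mem h𝔓 ρ, ← hn, Nat.floor_natCast]

/-- **The Hausdorff form of the conductor-exponent specification, all characteristics `≠ p`, from
the Hasse–Arf theorem and the finite-field case of Artin's theorem** (`hfin`, Katz 1.9 for
`A = 𝔽_λ`, needed only when `char A > 0`).
[cite: Katz1988, Ch. 1, Prop. 1.9 (proof) and Remark 1.10]
[cite: SerreLocalFields1979, Ch. VI §2, Thm 1' and Ch. IV §3, Theorem (Hasse–Arf)] -/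
theorem natCast_artinConductorExponent_of_t2Space_of_hasseArf
    (hHA : ∀ (R' K' L' : Type u) [CommRing R'] [Field K'] [Field L'] [Algebra R' K']
      [Algebra R' L'] [Algebra K' L'] [IsScalarTower R' K' L'], hasseArf R' (K := K') (L := L'))
    (hfin : ∀ {A' : Type v} [Field A'] {M' : Type v} [AddCommGroup M'] [Module A' M'],
      exists_natCast_eq_artinExponent_finiteField (K := K) (A := A') (M := M'))
    [NumberField K] {A : Type v} [Field A] [TopologicalSpace A] {M : Type w}
    [AddCommGroup M] [Module A M] [TopologicalSpace M] [T2Space M] [FiniteDimensional A M]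
    {v : HeightOneSpectrum (𝓞 K)} {𝔓 : Ideal (absIntegers (𝓞 K) K)} (h𝔓 : 𝔓 ∈ v.primesAbove)
    (ρ : GaloisRep K A M) (hchar : (v.residueCard : A) ≠ 0) (hρ : ρ.HasFiniteWildImageAt (𝓞 K) 𝔓) :
    (ρ.artinConductorExponent v : ℝ) = ρ.artinConductorAt (𝓞 K) 𝔓 :=
  natCast_artinConductorExponent_of_t2Space_of_arith
    (fun _ _ _ _ => card_inf_inertia_dvd_finsum_card_inf_ramificationSubgroup_of_hasseArf hHA) hfin
    h𝔓 ρ hchar hρ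

/-- **The finite-quotient form `natCast_artinConductorExponent_of_hasOpenInertiaKerAt` (Katz 1.9 as
printed), all characteristics `≠ p`, from the Hasse–Arf theorem and the finite-field case of
Artin's theorem.**  With `hasseArf_holds` and `exists_natCast_eq_artinExponent_finiteField_holds`
this is the discharge `natCast_artinConductorExponent_of_hasOpenInertiaKerAt_holds`.
[cite: Katz1988, Ch. 1, Prop. 1.9 (and its proof)]
[cite: SerreLocalFields1979, Ch. VI §2 Thm 1', §3, and Ch. IV §3, Theorem (Hasse–Arf)] -/
theorem natCast_artinConductorExponent_of_hasOpenInertiaKerAt_of_hasseArf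
    (hHA : ∀ (R' K' L' : Type u) [CommRing R'] [Field K'] [Field L'] [Algebra R' K']
      [Algebra R' L'] [Algebra K' L'] [IsScalarTower R' K' L'], hasseArf R' (K := K') (L := L'))
    (hfin : ∀ {A' : Type v} [Field A'] {M' : Type v} [AddCommGroup M'] [Module A' M'],
      exists_natCast_eq_artinExponent_finiteField (K := K) (A := A') (M := M'))
    [NumberField K] : natCast_artinConductorExponent_of_hasOpenInertiaKerAt.{u, v, w} (K := K) :=
  natCast_artinConductorExponent_of_hasOpenInertiaKerAt_of_arith
    (fun _ _ _ _ => card_inf_inertia_dvd_finsum_card_inf_ramificationSubgroup_of_hasseArf hHA) hfin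

end GaloisRep

end Literature.NumberTheory.GaloisRepresentations

end
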